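import Mathlib.NumberTheory.Padics.PadicVal.Basic
import Mathlib.NumberTheory.ArithmeticFunction.Misc
import Literature.AlgebraicGeometry.Frobenioids.PermutationOfPrimes
import Literature.AlgebraicGeometry.Frobenioids.BirationalNormalizationExample
import Literature.AlgebraicGeometry.Frobenioids.DivSlimExample
import Literature.AlgebraicGeometry.Frobenioids.SlimExponentiation
import Literature.AlgebraicGeometry.Frobenioids.AutSubAmpleCexBase
import HarnessLib

/-!
# Frobenioids I, Examples 3.8, 4.6, 4.7 (ii) and Appendix A.1: the example DATA are inhabited
# (abc-iut cell, layer L1, §4(iii) non-vacuity; NV-L1 rows `Ex38.Datum`, `Ex46.Datum`, `Ex47ii.G`,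
# `Coarsification`, `SliceCoarsification` of the kernel inhabitation census CENSUS-CELL-v3)

Mochizuki, *The geometry of Frobenioids I: the general theory*, Kyushu J. Math. **62** (2008)
293–400 [cite: MochizukiFrdI2008, Ex. 3.8 p.71] [cite: MochizukiFrdI2008, Ex. 4.6 p.86]
[cite: MochizukiFrdI2008, Ex. 4.7 (ii) p.87] [cite: MochizukiFrdI2008, Def. A.1(ii) p.118].

PROOF-ONLY file (no `def`, no `instance`, no `structure`): every witness is built inside a proof.
The typed example files `PermutationOfPrimes.lean` (Ex. 3.8), `BirationalNormalizationExample.lean`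
(Ex. 4.6), `DivSlimExample.lean` (Ex. 4.7 (ii)) and `SlimExponentiation.lean` (Appendix) state their
results over a *variable* datum (`P : Ex38.Datum`, `P : Ex46.Datum G`, …); no closed term of these
data types existed in the tree, so every such result — in particular the refutation
`Ex38.not_endLawAsPrinted` and the witness `Ex38.θ_not_preserves_degFr (h : ∃ m, P.α m ≠ m)` — was
formally consistent with the datum being uninhabited.  Here:

* **Example 3.8** (GENUINE model, label `_model`): for any two distinct primes `p ≠ q` there is a datum
  whose `α : N_{≥1} ⥲ N_{≥1}` is THE TRANSPOSITION of the primes `p` and `q` — print's "permutation of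
  primes", and `α ≠ id`, the case print's witnesses need ("[when `α` is not the identity]", p. 71).
  Construction: on `N = ℚ_{>0}`, `x ↦ x · (q/p)^{v_p(x) − v_q(x)}` (it swaps the `p`- and `q`-adic
  valuations), which is multiplicative, an involution, and carries `N_{≥1}` to itself
  (`exists_datum_swap`, `exists_datum_α_ne`, `nonempty_model`); consequence: print's "fails to
  preserve … Frobenius degrees" is REALIZED (`exists_θ_not_preserves_degFr`).
* **Example 4.6** (GENUINE model): in `G = ℤ`, `Ξ(n) := n · Ω(n)` (`Ω` = number of prime factors with
  multiplicity) satisfies the Leibniz rule `Ξ(mn) = m·Ξ(n) + n·Ξ(m)` and has `ξ_p = Ξ(p) = p ≠ 0` at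
  EVERY prime — the regime of print's "if the `ξ_p ≠ 0` …" (`Ex46.exists_datum_int`,
  `Ex46.nonempty_model`); the degenerate `Ξ = 0` datum over any `G` is recorded separately
  (`Ex46.nonempty_degenerate`).
* **Example 4.7 (ii)**: `G = V ⋊ N` is a group, hence inhabited, and `equivRatSemidirect` is onto
  (`Ex47ii.nonempty_model`, `Ex47ii.equivRatSemidirect_surjective`) — bookkeeping only.
* **Appendix A.1 (ii)**: the coarsification types are one-field wrappers; they are inhabited exactly
  when the underlying type is (`Coarsification.nonempty_iff`, `SliceCoarsification.nonempty_iff`)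
  — bookkeeping only ([wrapper]).

* `AutSubAmpleCex.BHom` (a hom-type of the Prop. 1.6 (vi) counterexample base): every object has its
  identity arrow (`AutSubAmpleCex.nonempty_bHom_self`) — bookkeeping only ([hom]).

RECONCILIATION of the two kernel censuses of the L1 interfaces (abc-iut-L1-lead R111 (2)): the eleven
substantive TYPE-valued zero-producer rows of abc-iut-w5-d056's CENSUS-CELL-v3 (2026-08-26 04:20Z) and of
abc-iut-w5-d197's INHABITATION-CENSUS-L1-v1 (04:30Z) COINCIDE name for name (both over the 02:59Z olean
horizon); per name — census source · producer:
`Ex38.Datum` — both · THIS FILE `Ex38.nonempty_model` (genuine); `Ex46.Datum` — both · THIS FILE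
`Ex46.nonempty_model` (genuine, `G = ℤ`) / `Ex46.nonempty_degenerate` (any `G`); `Ex47ii.G` — both ·
THIS FILE `Ex47ii.nonempty_model`; `Coarsification` — both · THIS FILE `Coarsification.nonempty_iff`
([wrapper]); `SliceCoarsification` — both · THIS FILE `SliceCoarsification.nonempty_iff` ([wrapper]);
`AutSubAmpleCex.BHom` — both · THIS FILE `AutSubAmpleCex.nonempty_bHom_self` ([hom]);
`PadicFrd.Datum.UnitSection`, `PadicFrd.RelEmb` — both · package B (abc-iut-L1-d3, file
`PadicFrobenioidSectionsNonVacuity.lean`); `PadicKummer.FNInvariant` — both · ALREADY WITNESSED in tree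
after the census horizon by `∃ inv : FNInvariant …` theorems of `PadicKummerRemark242Saturated.lean`,
`PadicKummerThm24iiLayer.lean`, `PadicKummerThm24iiOfGalois.lean` (W12 crew; no row needed);
`ArithRealification` — both · HELD by abc-iut-L1-d2 g3 (def-kind `ArithmeticRealificationInstance`,
files after the 05:00Z DEFS-FREEZE census, R108 (3)/R109 (4)); `FrdI.P25.Cor26Data` — both · OPEN
(built only inside the proof at `Prop25Sub.lean` l.304 under `FrdI.P25.Setting F`, itself a
Prop-structure with 0 producers in CENSUS-CELL-v3 — natural owner: the W7 lineage abc-iut-L6-t9).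
The six `[hom]` rows (`CFP.Hom`, `ElemFrobenioid.Hom`, `Ex43.Hom`, `FinEtale.Hom`, `FinSubextCat.Hom`,
`PadicFrd.PadicFld.Hom`) are hom-types of categories with identities (inhabited at every object by
`𝟙`); the Prop-structures `Cor57Hypotheses` (→ abc-iut-L1-d1 g3, R111 (1)), `FrdI.P25.Setting`,
`IsSkeletalSubcatFrTrPlbk` are listed by CENSUS-CELL-v3 only (w5-d197's method scans Type-valued
structures).

Honest framing: classical, undisputed mathematics; nothing here bears on [IUTchIII] Cor. 3.12; a
zero row of the census is «not yet witnessed», never «vacuous»; typed ≠ proved.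
-/

namespace Literature.AlgebraicGeometry.Frobenioids

open CategoryTheory

/-! ### Example 3.8: the transposition of two primes as a datum -/

namespace Ex38

open RatSemidirect

section Swap

variable (p q : ℕ) [hp : Fact p.Prime] [hq : Fact q.Prime]

/-- `q/p ≠ 0` in `ℚ`. [cite: MochizukiFrdI2008, Ex. 3.8 p.71] -/
private theorem ratio_ne_zero : ((q : ℚ) / p) ≠ 0 :=
  div_ne_zero (Nat.cast_ne_zero.mpr hq.out.ne_zero) (Nat.cast_ne_zero.mpr hp.out.ne_zero)

/-- `0 < q/p` in `ℚ`. [cite: MochizukiFrdI2008, Ex. 3.8 p.71] -/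
private theorem ratio_pos : 0 < ((q : ℚ) / p) :=
  div_pos (Nat.cast_pos.mpr hq.out.pos) (Nat.cast_pos.mpr hp.out.pos)

variable {p q}

/-- `v_p(q/p) = -1` for distinct primes. [cite: MochizukiFrdI2008, Ex. 3.8 p.71] -/
private theorem padicValRat_ratio_fst (hpq : p ≠ q) : padicValRat p ((q : ℚ) / p) = -1 := by
  rw [padicValRat.div (Nat.cast_ne_zero.mpr hq.out.ne_zero) (Nat.cast_ne_zero.mpr hp.out.ne_zero),
    padicValRat.of_nat, padicValRat.of_nat, padicValNat_primes hpq, padicValNat_self]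
  simp

/-- `v_q(q/p) = 1` for distinct primes. [cite: MochizukiFrdI2008, Ex. 3.8 p.71] -/
private theorem padicValRat_ratio_snd (hpq : p ≠ q) : padicValRat q ((q : ℚ) / p) = 1 := by
  rw [padicValRat.div (Nat.cast_ne_zero.mpr hq.out.ne_zero) (Nat.cast_ne_zero.mpr hp.out.ne_zero),
    padicValRat.of_nat, padicValRat.of_nat, padicValNat_primes (Ne.symm hpq), padicValNat_self]
  simp

variable (f : ℚ → ℚ)
  (hf : ∀ x, f x = x * ((q : ℚ) / p) ^ (padicValRat p x - padicValRat q x))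
include hf

/-- The swap map preserves non-vanishing. [cite: MochizukiFrdI2008, Ex. 3.8 p.71] -/
private theorem swap_ne_zero {x : ℚ} (hx : x ≠ 0) : f x ≠ 0 := by
  rw [hf]; exact mul_ne_zero hx (zpow_ne_zero _ (ratio_ne_zero p q))

/-- The swap map preserves positivity. [cite: MochizukiFrdI2008, Ex. 3.8 p.71] -/
private theorem swap_pos {x : ℚ} (hx : 0 < x) : 0 < f x := by
  rw [hf]; exact mul_pos hx (zpow_pos (ratio_pos p q) _)

/-- The swap map moves the `q`-adic valuation to the prime `p`. [cite: MochizukiFrdI2008, Ex. 3.8 p.71] -/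
private theorem padicValRat_swap_fst (hpq : p ≠ q) {x : ℚ} (hx : x ≠ 0) :
    padicValRat p (f x) = padicValRat q x := by
  rw [hf, padicValRat.mul hx (zpow_ne_zero _ (ratio_ne_zero p q)), padicValRat.zpow,
    padicValRat_ratio_fst hpq]
  ring

/-- The swap map moves the `p`-adic valuation to the prime `q`. [cite: MochizukiFrdI2008, Ex. 3.8 p.71] -/
private theorem padicValRat_swap_snd (hpq : p ≠ q) {x : ℚ} (hx : x ≠ 0) :
    padicValRat q (f x) = padicValRat p x := by
  rw [hf, padicValRat.mul hx (zpow_ne_zero _ (ratio_ne_zero p q)), padicValRat.zpow,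
    padicValRat_ratio_snd hpq]
  ring

/-- The swap map is an involution on `ℚ^×`. [cite: MochizukiFrdI2008, Ex. 3.8 p.71] -/
private theorem swap_swap (hpq : p ≠ q) {x : ℚ} (hx : x ≠ 0) : f (f x) = x := by
  rw [hf (f x), padicValRat_swap_fst f hf hpq hx, padicValRat_swap_snd f hf hpq hx, hf x, mul_assoc,
    ← zpow_add₀ (ratio_ne_zero p q)]
  have : padicValRat p x - padicValRat q x + (padicValRat q x - padicValRat p x) = 0 := by ring
  rw [this, zpow_zero, mul_one]

/-- The swap map is multiplicative on `ℚ^×`. [cite: MochizukiFrdI2008, Ex. 3.8 p.71] -/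
private theorem swap_mul {x y : ℚ} (hx : x ≠ 0) (hy : y ≠ 0) : f (x * y) = f x * f y := by
  rw [hf, hf x, hf y, padicValRat.mul hx hy, padicValRat.mul hx hy]
  have : padicValRat p x + padicValRat p y - (padicValRat q x + padicValRat q y) =
      (padicValRat p x - padicValRat q x) + (padicValRat p y - padicValRat q y) := by ring
  rw [this, zpow_add₀ (ratio_ne_zero p q)]
  ring

/-- On a positive integer `m = p^a q^b c` (`c` prime to `p`, `q`) the swap map takes the INTEGER value
`p^b q^a c`. [cite: MochizukiFrdI2008, Ex. 3.8 p.71] -/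
private theorem swap_natCast (hpq : p ≠ q) (m : ℕ) :
    f m = ((p ^ padicValNat q m * q ^ padicValNat p m *
      (m / (p ^ padicValNat p m * q ^ padicValNat q m)) : ℕ) : ℚ) := by
  set a := padicValNat p m with ha
  set b := padicValNat q m with hb
  have hcop : Nat.Coprime (p ^ a) (q ^ b) :=
    Nat.Coprime.pow a b ((Nat.coprime_primes hp.out hq.out).mpr hpq)
  have hdvd : p ^ a * q ^ b ∣ m :=
    hcop.mul_dvd_of_dvd_of_dvd pow_padicValNat_dvd pow_padicValNat_dvd
  obtain ⟨c, hc⟩ := hdvd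
  have hpa : (p : ℕ) ^ a * q ^ b ≠ 0 :=
    mul_ne_zero (pow_ne_zero _ hp.out.ne_zero) (pow_ne_zero _ hq.out.ne_zero)
  have hdiv : m / (p ^ a * q ^ b) = c := by
    rw [hc, Nat.mul_div_cancel_left _ (Nat.pos_of_ne_zero hpa)]
  rw [hdiv, hf, padicValRat.of_nat, padicValRat.of_nat, ← ha, ← hb]
  have hp0 : (p : ℚ) ≠ 0 := Nat.cast_ne_zero.mpr hp.out.ne_zero
  have hq0 : (q : ℚ) ≠ 0 := Nat.cast_ne_zero.mpr hq.out.ne_zero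
  have hzpow : ((q : ℚ) / p) ^ ((a : ℤ) - (b : ℤ)) = ((q : ℚ) ^ a / p ^ a) / ((q : ℚ) ^ b / p ^ b) := by
    rw [zpow_sub₀ (ratio_ne_zero p q), zpow_natCast, zpow_natCast, div_pow, div_pow]
  rw [hzpow, hc]
  push_cast
  field_simp

end Swap

/-- **Example 3.8 — the datum exists, GENUINELY**: for distinct primes `p ≠ q` there is a datum
`(α, αN)` of Ex. 3.8 whose automorphism `α` of the monoid `N_{≥1}` is the transposition of the primes
`p` and `q` (so `α(p) = q`): `αN(x) = x · (q/p)^{v_p(x) − v_q(x)}` on `N = ℚ_{>0}`, an involutive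
automorphism carrying `N_{≥1}` onto itself, and `α` its restriction.  Label: `_model`.
[cite: MochizukiFrdI2008, Ex. 3.8 p.71] -/
theorem exists_datum_swap (p q : ℕ) [hp : Fact p.Prime] [hq : Fact q.Prime] (hpq : p ≠ q) :
    ∃ P : Datum, (P.α ⟨p, hp.out.pos⟩ : ℕ+) = ⟨q, hq.out.pos⟩ := by
  -- the swap map on `ℚ` and its defining equation
  let f : ℚ → ℚ := fun x => x * ((q : ℚ) / p) ^ (padicValRat p x - padicValRat q x)
  have hf : ∀ x, f x = x * ((q : ℚ) / p) ^ (padicValRat p x - padicValRat q x) := fun _ => rfl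
  -- its restriction to `N = ℚ_{>0}` as a multiplicative involution
  let αN : N ≃* N :=
    { toFun := fun x => ⟨f x.1, swap_pos f hf x.2⟩
      invFun := fun x => ⟨f x.1, swap_pos f hf x.2⟩
      left_inv := fun x => Subtype.ext (swap_swap f hf hpq x.2.ne')
      right_inv := fun x => Subtype.ext (swap_swap f hf hpq x.2.ne')
      map_mul' := fun x y => Subtype.ext (by
        change f (x.1 * y.1) = f x.1 * f y.1
        exact swap_mul f hf x.2.ne' y.2.ne') }
  have hαN : ∀ x : N, ((αN x : N) : ℚ) = f x.1 := fun _ => rfl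
  -- the integer value on `N_{≥1}`
  let g : ℕ+ → ℕ := fun m =>
    p ^ padicValNat q m * q ^ padicValNat p m * (m / (p ^ padicValNat p m * q ^ padicValNat q m))
  have hg : ∀ m : ℕ+, ((g m : ℕ) : ℚ) = f m := fun m => (swap_natCast f hf hpq m).symm
  have hgpos : ∀ m : ℕ+, 0 < g m := by
    intro m
    have h : (0 : ℚ) < (g m : ℕ) := by rw [hg]; exact swap_pos f hf (by exact_mod_cast m.pos)
    exact_mod_cast h
  let α₀ : ℕ+ → ℕ+ := fun m => ⟨g m, hgpos m⟩
  have hbridge : ∀ m : ℕ+, natPos (α₀ m) = αN (natPos m) := by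
    intro m
    apply Subtype.ext
    rw [hαN, natPos_val, natPos_val]
    exact hg m
  have hα₀α₀ : ∀ m, α₀ (α₀ m) = m := by
    intro m
    apply natPos_injective
    rw [hbridge, hbridge]
    exact αN.left_inv (natPos m)
  let α : ℕ+ ≃* ℕ+ :=
    { toFun := α₀
      invFun := α₀
      left_inv := hα₀α₀
      right_inv := hα₀α₀
      map_mul' := fun m n => natPos_injective (by rw [map_mul, hbridge, hbridge, hbridge, map_mul, map_mul]) }
  have hcompat : ∀ m, αN (natPos m) = natPos (α m) := fun m => (hbridge m).symm
  have hinvol : ∀ n, αN (αN n) = n := fun n => αN.left_inv n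
  let P : Datum := { α := α, αN := αN, compat := hcompat, invol := hinvol }
  refine ⟨P, ?_⟩
  -- `α(p) = q`
  apply PNat.coe_injective
  change g ⟨p, hp.out.pos⟩ = q
  simp only [g, PNat.mk_coe, padicValNat_self, padicValNat_primes (Ne.symm hpq), pow_zero, pow_one,
    one_mul, mul_one]
  rw [Nat.div_self hp.out.pos, mul_one]

/-- **Example 3.8 — a datum with `α ≠ id`** (the hypothesis `∃ m, P.α m ≠ m` of
`Ex38.θ_not_preserves_degFr`), at the primes `2, 3`. [cite: MochizukiFrdI2008, Ex. 3.8 p.71] -/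
theorem exists_datum_α_ne : ∃ P : Datum, ∃ m : ℕ+, P.α m ≠ m := by
  haveI : Fact (Nat.Prime 2) := ⟨Nat.prime_two⟩
  haveI : Fact (Nat.Prime 3) := ⟨Nat.prime_three⟩
  obtain ⟨P, hP⟩ := exists_datum_swap 2 3 (by decide)
  refine ⟨P, ⟨2, Nat.prime_two.pos⟩, ?_⟩
  rw [hP]
  intro h
  have h' : (3 : ℕ) = 2 := congrArg PNat.val h
  omega

/-- **Example 3.8 — the datum type is inhabited** (NV-L1 row `Ex38.Datum`; label `_model`, via the
transposition `(2 3)`). [cite: MochizukiFrdI2008, Ex. 3.8 p.71] -/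
theorem nonempty_model : Nonempty Literature.AlgebraicGeometry.Frobenioids.Ex38.Datum :=
  let ⟨P, _⟩ := exists_datum_α_ne; ⟨P⟩

/-- **Example 3.8 — "fails to preserve … Frobenius degrees [when `α` is not equal to the identity]"
REALIZED**: there is a datum for which the printed automorphism `θ` of the monoid `M` moves the
Frobenius-degree coordinate of some element (instance of `Ex38.θ_not_preserves_degFr`).
[cite: MochizukiFrdI2008, Ex. 3.8 p.71] -/
theorem exists_θ_not_preserves_degFr : ∃ (P : Datum) (x : M P), (θ P x).m ≠ x.m := by
  obtain ⟨P, hP⟩ := exists_datum_α_ne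
  exact ⟨P, θ_not_preserves_degFr P hP⟩

/-- **Example 3.8 — also "fails to preserve `O^×(−)`" holds at an ACTUAL datum** (instance of
`Ex38.θ_not_preserves_units`). [cite: MochizukiFrdI2008, Ex. 3.8 p.71] -/
theorem exists_θ_not_preserves_units : ∃ (P : Datum) (x : M P), x.u = 0 ∧ (θ P x).u ≠ 0 := by
  obtain ⟨P⟩ := nonempty_model
  exact ⟨P, θ_not_preserves_units P⟩

end Ex38

/-! ### Example 4.6: the Leibniz datum `Ξ(n) = n · Ω(n)` -/

namespace Ex46

/-- **Example 4.6 — the datum exists with EVERY `ξ_p ≠ 0`** (GENUINE model, `G = ℤ`):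
`Ξ(n) := n · Ω(n)`, `Ω(n)` the number of prime factors of `n` counted with multiplicity, satisfies the
Leibniz rule `Ξ(mn) = m·Ξ(n) + n·Ξ(m)` (additivity of `Ω`), and `ξ_p = Ξ(p) = p ≠ 0` for every prime
`p` — the regime "if the `ξ_p ≠ 0`" of print.  Label: `_model`. [cite: MochizukiFrdI2008, Ex. 4.6 p.86] -/
theorem exists_datum_int :
    ∃ P : Datum ℤ, (∀ n : ℕ+, P.Ξ n = (n : ℤ) * ArithmeticFunction.cardFactors (n : ℕ)) ∧
      ∀ p : ℕ+, (p : ℕ).Prime → P.Ξ p = (p : ℤ) ∧ P.Ξ p ≠ 0 := by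
  refine ⟨{ Ξ := fun n => (n : ℤ) * ArithmeticFunction.cardFactors (n : ℕ), leibniz := ?_ }, fun _ => rfl, ?_⟩
  · intro m n
    simp only [PNat.mul_coe, Nat.cast_mul, zsmul_eq_mul]
    rw [ArithmeticFunction.cardFactors_mul m.ne_zero n.ne_zero]
    push_cast
    ring
  · intro p hp
    have h1 : ArithmeticFunction.cardFactors (p : ℕ) = 1 := ArithmeticFunction.cardFactors_apply_prime hp
    refine ⟨by simp [h1], ?_⟩
    simp [h1, hp.ne_zero]

/-- **Example 4.6 — the datum type is inhabited** (NV-L1 row `Ex46.Datum`, at `G = ℤ`; label `_model`).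
[cite: MochizukiFrdI2008, Ex. 4.6 p.86] -/
theorem nonempty_model : Nonempty (Literature.AlgebraicGeometry.Frobenioids.Ex46.Datum ℤ) :=
  let ⟨P, _⟩ := exists_datum_int; ⟨P⟩

/-- **Example 4.6 — the degenerate datum** `Ξ = 0` over an arbitrary abelian group `G` (all
`ξ_p = 0`; label `_degenerate`, recorded only to inhabit `Datum G` for every `G`).
[cite: MochizukiFrdI2008, Ex. 4.6 p.86] -/
theorem nonempty_degenerate (G : Type) [AddCommGroup G] :
    Nonempty (Literature.AlgebraicGeometry.Frobenioids.Ex46.Datum G) :=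
  ⟨{ Ξ := fun _ => 0, leibniz := fun _ _ => by simp }⟩

end Ex46

/-! ### Example 4.7 (ii): the group `G = V ⋊ N` -/

namespace Ex47ii

/-- **Example 4.7 (ii) — `G = V ⋊ N` is inhabited** (it is a group; NV-L1 row `Ex47ii.G`,
bookkeeping). [cite: MochizukiFrdI2008, Ex. 4.7 (ii) p.87] -/
theorem nonempty_model : Nonempty Literature.AlgebraicGeometry.Frobenioids.Ex47ii.G := ⟨1⟩

/-- **Example 4.7 (ii)** — every element of `G` comes from `U ⋊ N` of Ex. 3.8/3.9 along the
`N`-inverting isomorphism `equivRatSemidirect` (so `G` has as many producers as `RatSemidirect.G`).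
[cite: MochizukiFrdI2008, Ex. 4.7 (ii) p.87] -/
theorem equivRatSemidirect_surjective : Function.Surjective Ex47ii.equivRatSemidirect :=
  Ex47ii.equivRatSemidirect.surjective

/-- **Example 4.7 (ii)** — `G` has an element with non-trivial `V`- and `N`-coordinates (it is not
the trivial group). [cite: MochizukiFrdI2008, Ex. 4.7 (ii) p.87] -/
theorem exists_ne_one : ∃ g : G, g ≠ 1 := by
  refine ⟨⟨1, 1⟩, fun h => ?_⟩
  have : (1 : ℚ) = 0 := congrArg G.v h
  exact one_ne_zero this

end Ex47ii

/-! ### Prop. 1.6 (vi) counterexample base: hom-types -/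

/-- The hom-type `BHom X X` of the Prop. 1.6 (vi) counterexample base contains the identity label `0`
(NV-L1 row `AutSubAmpleCex.BHom`; [hom]). [cite: MochizukiFrdI2008, Prop. 1.6(vi) p.27] -/
theorem AutSubAmpleCex.nonempty_bHom_self (X : AutSubAmpleCex.BObj) :
    Nonempty (AutSubAmpleCex.BHom X X) :=
  ⟨⟨0, AutSubAmpleCex.homValid_zero X⟩⟩

/-! ### Appendix, Definition A.1 (ii): coarsifications are inhabited iff the underlying type is -/

/-- **Definition A.1 (ii)** — the coarsification `|B|` has the same objects as `B`: it is inhabited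
iff `B` is (NV-L1 row `Coarsification`; [wrapper]). [cite: MochizukiFrdI2008, Def. A.1(ii) p.118] -/
theorem Coarsification.nonempty_iff (B : Type*) : Nonempty (Coarsification B) ↔ Nonempty B :=
  ⟨fun ⟨x⟩ => ⟨x.as⟩, fun ⟨b⟩ => ⟨⟨b⟩⟩⟩

/-- **Proposition A.2** — `|D|` has one object `C_A` per object `A` of `C`: it is inhabited iff `C` is
(NV-L1 row `SliceCoarsification`; [wrapper]). [cite: MochizukiFrdI2008, Prop. A.2 p.118] -/
theorem SliceCoarsification.nonempty_iff (C : Type*) :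
    Nonempty (SliceCoarsification C) ↔ Nonempty C :=
  ⟨fun ⟨x⟩ => ⟨x.as⟩, fun ⟨A⟩ => ⟨⟨A⟩⟩⟩

/-- **Proposition A.2** — every object of `|D|` is the class `C_A` of an object of `C` (the slim
exponentiation functor is surjective on objects by construction). [cite: MochizukiFrdI2008, Prop. A.2 p.118] -/
theorem SliceCoarsification.exists_eq_mk {C : Type*} (X : SliceCoarsification C) :
    ∃ A : C, X = ⟨A⟩ :=
  ⟨X.as, rfl⟩

end Literature.AlgebraicGeometry.Frobenioids
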